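import Summits.FinalStateConjecture.FinalStateConjecture.Theorems.SwallowTheDatumParametricKerrBurialLine
import Summits.FinalStateConjecture.FinalStateConjecture.Theorems.SwallowTheDatumParametricKerrBurialStubBreathing
import Summits.FinalStateConjecture.FinalStateConjecture.Theorems.SwallowTheDatumUniversalWitnessFamilyThroatSettlesToo
import Literature.Geometry.Lorentzian.ModelData
import Literature.Geometry.Lorentzian.InitialDataPullback
import Literature.Geometry.Lorentzian.AFEndBreathingData
import Literature.Geometry.Lorentzian.AFEndUnbreathe
import Literature.Geometry.Lorentzian.AdmissibleDataLocality
import HarnessLib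

/-!
# Stub `stub_throatBreathing` of the line `Sketch` (`throat-settles-too`)
(crux `SwallowTheDatum.UniversalWitnessFamily`, item stmt-FinalStateConjecture-10051)

From a radius-indexed family `P R` (`R > R⋆`) of admissible THROAT-SHIELDED data on `X` agreeing
with the datum `d` off the far region `e.far R`, with sections jointly smooth in `(R, x)`, produce
the two-parameter family `S (R, t)`, the one-parameter family `E t` through `d = E 0`, and a marker
`(x₀, v₀)` making `t ↦ h_{E t}(x₀)(v₀, v₀)` injective — the ingredients of the junction lemma
`Theorems.SwallowTheDatum.ParametricKerrBurial.junction`.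

Construction (breathing, verbatim the sibling stub `stub_breathing` of
`Theorems/SwallowTheDatumParametricKerrBurialStubBreathing.lean`): inside the coordinate shell
`{R < ‖coord‖ < R⋆}` of the end `e` choose a coordinate ball (`exists_breathingData_le`) and let
`Φ_t = breathe (σ t)` be the breathing diffeomorphisms of `X` supported in it (`AFEndBreathing`,
`AFEndUnbreathe`); set `E t := Φ_t^* d` and `S (R, t) := Φ_t^* (P R)` (`AFEnd.breatheFamily`).
Then `E 0 = d`; the families are jointly smooth (`contMDiff_breatheFamily_h/k`; for `S`, on the
carrier `S (R, t) = E t` because `P R = d` there, off the moved set `S (R, t) = P R`);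
`S (R, t) = E t` off `e.far R`; the marker is injective (`injective_marker`); `S (R, t)` is
admissible (vacuum by naturality, the end by `AdmissibleDataLocality`). The only new ingredient is
§1: the THROAT shield (outside a compact set the datum is the exact isotropic Schwarzschild slice
`((1 + M/2‖y‖)⁴ δ, 0)` on `{‖y‖ > R₁}`, `R₁ < M/2`, through an open embedding `Φ`) is carried
through a diffeomorphism `Θ` with smooth inverse `Ψ`: the shield of `Θ^* D` is the chart `Ψ ∘ Φ`
with the SAME `(M, R₁)`, since `(Ψ ∘ Φ)^*(Θ^* D) = (Θ ∘ Ψ ∘ Φ)^* D = Φ^* D` (pointwise chain rule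
`pullbackBilin_comp_apply'`), images and co-compact far zones transfer along the homeomorphism `Ψ`.

References: Lines/throat-settles-too.md; J. M. Lee, *Introduction to Smooth Manifolds* (2013),
Ch. 9 (compactly supported diffeomorphisms); B. O'Neill, *Semi-Riemannian geometry* (1983), Ch. 3,
p. 58 (pullbacks compose).
-/

-- the doubled `FinalStateConjecture` path component is the summit/problem naming scheme, not a mistake
set_option linter.dupNamespace false

noncomputable section

namespace Summit.FinalStateConjecture.FinalStateConjecture.Theorems.SwallowTheDatum.UniversalWitnessFamily

open scoped Manifold ContDiff Topology
open Bundle Set Filter Function Metric Literature.Geometry.Lorentzian Literature.Geometry.Manifold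
open Summit.FinalStateConjecture.FinalStateConjecture.Theorems.SwallowTheDatum.ParametricKerrBurial
  (SmoothSectionsOn AgreeAt IsExactSchwarzschildBeyond IsSchwarzschildAnnulus)
open Summit.FinalStateConjecture.FinalStateConjecture.Theorems.SwallowTheDatum.UniversalWitnessFamily.ThroatSettlesToo
  (zero_notMem_exteriorRegion)

variable {X : Type} [TopologicalSpace X] [ChartedSpace E3 X] [IsManifold (𝓡 3) ∞ X]

/-! ## §1 The throat shield is invariant under pullback by diffeomorphisms -/

/-- **The throat shield is invariant under pullback by a diffeomorphism.** Let `D` be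
throat-shielded (chart `Φ : {‖y‖ > R₁} → X`, parameters `(M, R₁)`) and let `Θ : X → X` be smooth
with injective differentials and with a smooth two-sided inverse `Ψ`. Then `Θ^* D = D.comap Θ` is
throat-shielded with chart `Ψ ∘ Φ` and the same `(M, R₁)`:
`(Ψ ∘ Φ)^*(Θ^* D) = (Θ ∘ Ψ ∘ Φ)^* D = Φ^* D`. [folklore] -/
theorem throatBreathing_shield_comap_of_inverse {D : InitialDataSet (𝓡 3) X}
    (hD : ∃ (M R₁ : ℝ) (hM : 0 < M) (hR : 0 < R₁), R₁ < M / 2 ∧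
      ∃ (Φ : exteriorRegion R₁ → X) (hΦ : ContMDiff 𝓘(ℝ, E3) (𝓡 3) (∞ + 1) Φ)
        (hΦ' : ∀ u, Function.Injective (mfderiv 𝓘(ℝ, E3) (𝓡 3) Φ u)),
        Topology.IsOpenEmbedding Φ ∧
        (∀ R' : ℝ, IsCompact (Φ '' {y : exteriorRegion R₁ | R' < ‖(y : E3)‖})ᶜ) ∧
        D.comap Φ hΦ hΦ' = Schwarzschild.conformalData (M := M) (exteriorRegion R₁) hM.le
          (zero_notMem_exteriorRegion hR))
    (Θ : X → X) (hΘ : ContMDiff (𝓡 3) (𝓡 3) (∞ + 1) Θ)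
    (hΘ' : ∀ u, Injective (mfderiv (𝓡 3) (𝓡 3) Θ u)) (Ψ : X → X)
    (hΨ : ContMDiff (𝓡 3) (𝓡 3) ∞ Ψ) (hΨΘ : ∀ x, Ψ (Θ x) = x) (hΘΨ : ∀ x, Θ (Ψ x) = x) :
    ∃ (M R₁ : ℝ) (hM : 0 < M) (hR : 0 < R₁), R₁ < M / 2 ∧
      ∃ (Φ : exteriorRegion R₁ → X) (hΦ : ContMDiff 𝓘(ℝ, E3) (𝓡 3) (∞ + 1) Φ)
        (hΦ' : ∀ u, Function.Injective (mfderiv 𝓘(ℝ, E3) (𝓡 3) Φ u)),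
        Topology.IsOpenEmbedding Φ ∧
        (∀ R' : ℝ, IsCompact (Φ '' {y : exteriorRegion R₁ | R' < ‖(y : E3)‖})ᶜ) ∧
        (D.comap Θ hΘ hΘ').comap Φ hΦ hΦ' = Schwarzschild.conformalData (M := M) (exteriorRegion R₁)
          hM.le (zero_notMem_exteriorRegion hR) := by
  obtain ⟨M, R₁, hM, hR, hRM, Φ, hΦ, hΦ', hopen, hfar, hexact⟩ := hD
  have hΘs : ContMDiff (𝓡 3) (𝓡 3) ∞ Θ := hΘ.of_le le_self_add
  -- `Θ` as a homeomorphism with inverse `Ψ`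
  let H : X ≃ₜ X :=
    { toFun := Θ
      invFun := Ψ
      left_inv := hΨΘ
      right_inv := hΘΨ
      continuous_toFun := hΘs.continuous
      continuous_invFun := hΨ.continuous }
  have hHsymm : ⇑H.symm = Ψ := rfl
  have hbij : Bijective Ψ := by rw [← hHsymm]; exact H.symm.bijective
  -- the new shielding chart `Ψ ∘ Φ`
  have hΨ' : ContMDiff (𝓡 3) (𝓡 3) (∞ + 1) Ψ := hΨ
  have hφs : ContMDiff 𝓘(ℝ, E3) (𝓡 3) (∞ + 1) (Ψ ∘ Φ) := hΨ'.comp hΦ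
  have hcomp : Θ ∘ (Ψ ∘ Φ) = Φ := funext fun y ↦ hΘΨ (Φ y)
  have hΘd : ∀ x, MDifferentiableAt (𝓡 3) (𝓡 3) Θ x := fun x ↦ (hΘs x).mdifferentiableAt (by simp)
  have hφd : ∀ y, MDifferentiableAt 𝓘(ℝ, E3) (𝓡 3) (Ψ ∘ Φ) y := fun y ↦
    (hφs y).mdifferentiableAt (by simp)
  have hinj : ∀ u, Injective (mfderiv 𝓘(ℝ, E3) (𝓡 3) (Ψ ∘ Φ) u) := by
    intro u
    have h := hΦ' u
    rw [← hcomp, mfderiv_comp u (hΘd ((Ψ ∘ Φ) u)) (hφd u)] at h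
    exact Injective.of_comp (f := ⇑(mfderiv (𝓡 3) (𝓡 3) Θ ((Ψ ∘ Φ) u))) h
  have hemb : Topology.IsOpenEmbedding (Ψ ∘ Φ) := by
    rw [← hHsymm]
    exact H.symm.isOpenEmbedding.comp hopen
  -- the chain rule for the two pullbacks: `(Ψ ∘ Φ)^*(Θ^* b) = (Θ ∘ Ψ ∘ Φ)^* b = Φ^* b`
  have hchain : ∀ (b : Π x : X, TangentSpace (𝓡 3) x →L[ℝ] TangentSpace (𝓡 3) x →L[ℝ] ℝ)
      (y : exteriorRegion R₁),
      pullbackBilin (I := 𝓡 3) (I' := 𝓘(ℝ, E3)) (Ψ ∘ Φ)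
          (pullbackBilin (I := 𝓡 3) (I' := 𝓡 3) Θ b) y =
        pullbackBilin (I := 𝓡 3) (I' := 𝓘(ℝ, E3)) Φ b y := by
    intro b y
    rw [← pullbackBilin_comp_apply' (hΘd ((Ψ ∘ Φ) y)) (hφd y) b, hcomp]
  refine ⟨M, R₁, hM, hR, hRM, Ψ ∘ Φ, hφs, hinj, hemb, fun R' ↦ ?_, Eq.trans ?_ hexact⟩
  · -- co-compact far zones transfer along the homeomorphism `Ψ`
    rw [Set.image_comp, ← Set.image_compl_eq hbij]
    exact (hfar R').image hΨ.continuous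
  · -- the data identity `(Ψ ∘ Φ)^*(Θ^* D) = Φ^* D`
    refine InitialDataSet.ext' (fun u v w ↦ ?_) (fun u v w ↦ ?_)
    · have hL : ((D.comap Θ hΘ hΘ').comap (Ψ ∘ Φ) hφs hinj).h.inner =
          pullbackBilin (I := 𝓡 3) (I' := 𝓘(ℝ, E3)) (Ψ ∘ Φ)
            (pullbackBilin (I := 𝓡 3) (I' := 𝓡 3) Θ D.h.inner) := rfl
      have hR' : (D.comap Φ hΦ hΦ').h.inner =
          pullbackBilin (I := 𝓡 3) (I' := 𝓘(ℝ, E3)) Φ D.h.inner := rfl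
      rw [hL, hR', hchain]
    · have hL : ((D.comap Θ hΘ hΘ').comap (Ψ ∘ Φ) hφs hinj).k =
          pullbackBilin (I := 𝓡 3) (I' := 𝓘(ℝ, E3)) (Ψ ∘ Φ)
            (pullbackBilin (I := 𝓡 3) (I' := 𝓡 3) Θ D.k) := rfl
      have hR' : (D.comap Φ hΦ hΦ').k = pullbackBilin (I := 𝓡 3) (I' := 𝓘(ℝ, E3)) Φ D.k := rfl
      rw [hL, hR', hchain]

/-- **Breathing preserves the throat shield**: for breathing data `B` and any `t`, the breathed
datum `breatheFamily B D t = (breathe (σ t))^* D` of a throat-shielded `D` is throat-shielded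
(`|σ t|` is below the inverse threshold, so `breathe (σ t)` has a smooth inverse, `AFEndUnbreathe`).
[folklore] -/
theorem throatBreathing_shield_breatheFamily [T2Space X] {e : AFEnd X} {z₀ : E3} {r : ℝ}
    (B : AFEnd.BreathingData e z₀ r) {D : InitialDataSet (𝓡 3) X}
    (hD : ∃ (M R₁ : ℝ) (hM : 0 < M) (hR : 0 < R₁), R₁ < M / 2 ∧
      ∃ (Φ : exteriorRegion R₁ → X) (hΦ : ContMDiff 𝓘(ℝ, E3) (𝓡 3) (∞ + 1) Φ)
        (hΦ' : ∀ u, Function.Injective (mfderiv 𝓘(ℝ, E3) (𝓡 3) Φ u)),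
        Topology.IsOpenEmbedding Φ ∧
        (∀ R' : ℝ, IsCompact (Φ '' {y : exteriorRegion R₁ | R' < ‖(y : E3)‖})ᶜ) ∧
        D.comap Φ hΦ hΦ' = Schwarzschild.conformalData (M := M) (exteriorRegion R₁) hM.le
          (zero_notMem_exteriorRegion hR)) (t : ℝ) :
    ∃ (M R₁ : ℝ) (hM : 0 < M) (hR : 0 < R₁), R₁ < M / 2 ∧
      ∃ (Φ : exteriorRegion R₁ → X) (hΦ : ContMDiff 𝓘(ℝ, E3) (𝓡 3) (∞ + 1) Φ)
        (hΦ' : ∀ u, Function.Injective (mfderiv 𝓘(ℝ, E3) (𝓡 3) Φ u)),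
        Topology.IsOpenEmbedding Φ ∧
        (∀ R' : ℝ, IsCompact (Φ '' {y : exteriorRegion R₁ | R' < ‖(y : E3)‖})ᶜ) ∧
        (AFEnd.breatheFamily B D t).comap Φ hΦ hΦ' = Schwarzschild.conformalData (M := M)
          (exteriorRegion R₁) hM.le (zero_notMem_exteriorRegion hR) := by
  obtain ⟨Ψ, hΨ, h1, h2, -⟩ := AFEnd.exists_smooth_inverse_breathe B (AFEnd.abs_squash_lt_invScale B t)
  exact throatBreathing_shield_comap_of_inverse hD _ _ _ Ψ hΨ h1 h2

/-! ## §2 The stub -/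

/-- **Stub `stub_throatBreathing`** (registered signature, line `Sketch`, `throat-settles-too`, crux
item stmt-FinalStateConjecture-10051): the two-parameter family `S (R, t) = Φ_t^* (P R)`, the
one-parameter family `E t = Φ_t^* d` through `d`, and an injective marker, where `Φ_t` are the
breathing diffeomorphisms supported in a coordinate ball of the shell `{R < ‖coord‖ < R⋆}`; the
throat shield of `P R` is carried through `Φ_t`. [folklore] -/
theorem stub_throatBreathing :
    ∀ (X : Type) [TopologicalSpace X] [ChartedSpace E3 X] [IsManifold (𝓡 3) ∞ X] [T2Space X]
      [SecondCountableTopology X] [ConnectedSpace X] (d : InitialDataSet (𝓡 3) X) (e : AFEnd X)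
      (Rstar : ℝ) (P : ℝ → InitialDataSet (𝓡 3) X), e.R < Rstar →
      SmoothSectionsOn 𝓘(ℝ, ℝ) P {p : ℝ × X | Rstar < p.1} →
      (∀ R : ℝ, Rstar < R → P R ∈ admissibleVacuumData X ∧
        (∃ (M R₁ : ℝ) (hM : 0 < M) (hR : 0 < R₁), R₁ < M / 2 ∧
          ∃ (Φ : exteriorRegion R₁ → X) (hΦ : ContMDiff 𝓘(ℝ, E3) (𝓡 3) (∞ + 1) Φ)
            (hΦ' : ∀ u, Function.Injective (mfderiv 𝓘(ℝ, E3) (𝓡 3) Φ u)),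
            Topology.IsOpenEmbedding Φ ∧
            (∀ R' : ℝ, IsCompact (Φ '' {y : exteriorRegion R₁ | R' < ‖(y : E3)‖})ᶜ) ∧
            (P R).comap Φ hΦ hΦ' = Schwarzschild.conformalData (M := M) (exteriorRegion R₁) hM.le
              (zero_notMem_exteriorRegion hR)) ∧
        ∀ x ∉ e.far R, AgreeAt (P R) d x) →
      ∃ (S : ℝ × ℝ → InitialDataSet (𝓡 3) X) (E : ℝ → InitialDataSet (𝓡 3) X) (x₀ : X)
        (v₀ : TangentSpace (𝓡 3) x₀),
        SmoothSectionsOn (𝓘(ℝ, ℝ).prod 𝓘(ℝ, ℝ)) S {p : (ℝ × ℝ) × X | Rstar < p.1.1} ∧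
        SmoothSectionsOn 𝓘(ℝ, ℝ) E (Set.univ : Set (ℝ × X)) ∧ E 0 = d ∧
        (∀ R t : ℝ, Rstar < R → ∀ x ∉ e.far R, AgreeAt (S (R, t)) (E t) x) ∧ x₀ ∉ e.far Rstar ∧
        Set.InjOn (fun t : ℝ ↦ (E t).h.inner x₀ v₀ v₀) (Set.Ioo (-1) 1) ∧
        ∀ R t : ℝ, Rstar < R → |t| < 1 → S (R, t) ∈ admissibleVacuumData X ∧
          ∃ (M R₁ : ℝ) (hM : 0 < M) (hR : 0 < R₁), R₁ < M / 2 ∧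
            ∃ (Φ : exteriorRegion R₁ → X) (hΦ : ContMDiff 𝓘(ℝ, E3) (𝓡 3) (∞ + 1) Φ)
              (hΦ' : ∀ u, Function.Injective (mfderiv 𝓘(ℝ, E3) (𝓡 3) Φ u)),
              Topology.IsOpenEmbedding Φ ∧
              (∀ R' : ℝ, IsCompact (Φ '' {y : exteriorRegion R₁ | R' < ‖(y : E3)‖})ᶜ) ∧
              (S (R, t)).comap Φ hΦ hΦ' = Schwarzschild.conformalData (M := M) (exteriorRegion R₁) hM.le
                (zero_notMem_exteriorRegion hR) := by
  -- adapted from `Theorems/SwallowTheDatumParametricKerrBurialStubBreathing.lean` (`stub_breathing`)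
  intro X _ _ _ _ _ _ d e Rstar P hR hP hPR
  -- the breathing ball and the breathing families
  obtain ⟨z₀, r, B, hzr⟩ := ParametricKerrBurial.exists_breathingData_le e hR
  let E : ℝ → InitialDataSet (𝓡 3) X := fun t ↦ AFEnd.breatheFamily B d t
  let S : ℝ × ℝ → InitialDataSet (𝓡 3) X := fun q ↦ AFEnd.breatheFamily B (P q.1) q.2
  let x₀ : X := e.dataChartExt z₀
  let v₀ : TangentSpace (𝓡 3) x₀ := (EuclideanSpace.single 0 1 : E3)
  have hv₀ : v₀ ≠ 0 := by
    intro h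
    have h1 : ‖(EuclideanSpace.single (0 : Fin 3) (1 : ℝ) : E3)‖ = 1 := by simp
    have h2 : (EuclideanSpace.single (0 : Fin 3) (1 : ℝ) : E3) = 0 := h
    rw [h2, norm_zero] at h1
    exact zero_ne_one h1
  -- `P R = d` on the carrier (`R > R⋆`), and at breathed points of the complement of `far R`
  have hcarrier : ∀ {R : ℝ}, Rstar < R → ∀ {x : X}, x ∈ e.breatheCarrier z₀ r → x ∉ e.far R :=
    fun hRR _ hx ↦ ParametricKerrBurial.not_mem_far_of_mem_carrier e hzr hRR.le hx
  have hagree_breathe : ∀ {R : ℝ}, Rstar < R → ∀ (t : ℝ) {x : X}, x ∉ e.far R →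
      AgreeAt (P R) d (e.breathe z₀ r (AFEnd.squash B t) x) := by
    intro R hRR t x hx
    refine (hPR R hRR).2.2 _ ?_
    by_cases hxc : x ∈ e.breatheCarrier z₀ r
    · exact hcarrier hRR
        ⟨(AFEnd.breathe_mem_and_coord B (AFEnd.abs_squash_lt_scale B t).2 hxc).1, by
          rw [(AFEnd.breathe_mem_and_coord B (AFEnd.abs_squash_lt_scale B t).2 hxc).2]
          exact AFEnd.phi_mem_ball_of_lt_invScale (AFEnd.abs_squash_lt_invScale B t) hxc.2⟩
    · rwa [e.breathe_of_not_mem hxc]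
  -- `S (R, t)` and `E t` agree wherever `P R` and `d` agree at the breathed point
  have hSE : ∀ {R : ℝ} (t : ℝ) {x : X}, AgreeAt (P R) d (e.breathe z₀ r (AFEnd.squash B t) x) →
      AgreeAt (S (R, t)) (E t) x := by
    intro R t x hag
    refine ⟨?_, ?_⟩
    · ext v w
      rw [AFEnd.breatheFamily_h_inner, AFEnd.breatheFamily_h_inner, hag.1]
    · ext v w
      rw [AFEnd.breatheFamily_k, AFEnd.breatheFamily_k, hag.2]
  -- the section maps of `E`
  have hEh := AFEnd.contMDiff_breatheFamily_h B d
  have hEk := AFEnd.contMDiff_breatheFamily_k B d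
  refine ⟨S, E, x₀, v₀, ?_, ⟨hEh.contMDiffOn, hEk.contMDiffOn⟩, AFEnd.breatheFamily_zero B d,
    fun R t hRR x hx ↦ hSE t (hagree_breathe hRR t hx), ?_, ?_, fun R t hRR _ ↦ ⟨?_, ?_⟩⟩
  · -- joint smoothness of `S` on `{R⋆ < R}`
    have hopen : IsOpen {p : (ℝ × ℝ) × X | Rstar < p.1.1} :=
      isOpen_lt continuous_const (continuous_fst.comp continuous_fst)
    have hproj₂ : ContMDiff ((𝓘(ℝ, ℝ).prod 𝓘(ℝ, ℝ)).prod (𝓡 3)) (𝓘(ℝ, ℝ).prod (𝓡 3)) ∞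
        (fun q : (ℝ × ℝ) × X ↦ (q.1.2, q.2)) :=
      (contMDiff_snd.comp contMDiff_fst).prodMk contMDiff_snd
    have hproj₁ : ContMDiff ((𝓘(ℝ, ℝ).prod 𝓘(ℝ, ℝ)).prod (𝓡 3)) (𝓘(ℝ, ℝ).prod (𝓡 3)) ∞
        (fun q : (ℝ × ℝ) × X ↦ (q.1.1, q.2)) :=
      (contMDiff_fst.comp contMDiff_fst).prodMk contMDiff_snd
    -- generic argument for a section `sec` (`h` or `k`)
    have key : ∀ (secS : Π q : (ℝ × ℝ) × X, TangentSpace (𝓡 3) q.2 →L[ℝ] TangentSpace (𝓡 3) q.2 →L[ℝ] ℝ)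
        (secE : Π q : ℝ × X, TangentSpace (𝓡 3) q.2 →L[ℝ] TangentSpace (𝓡 3) q.2 →L[ℝ] ℝ)
        (secP : Π q : ℝ × X, TangentSpace (𝓡 3) q.2 →L[ℝ] TangentSpace (𝓡 3) q.2 →L[ℝ] ℝ),
        ContMDiff (𝓘(ℝ, ℝ).prod (𝓡 3)) ((𝓡 3).prod 𝓘(ℝ, E3 →L[ℝ] E3 →L[ℝ] ℝ)) ∞
          (fun q : ℝ × X ↦ TotalSpace.mk' (E3 →L[ℝ] E3 →L[ℝ] ℝ)
            (E := fun x : X ↦ TangentSpace (𝓡 3) x →L[ℝ] TangentSpace (𝓡 3) x →L[ℝ] ℝ) q.2 (secE q)) →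
        ContMDiffOn (𝓘(ℝ, ℝ).prod (𝓡 3)) ((𝓡 3).prod 𝓘(ℝ, E3 →L[ℝ] E3 →L[ℝ] ℝ)) ∞
          (fun q : ℝ × X ↦ TotalSpace.mk' (E3 →L[ℝ] E3 →L[ℝ] ℝ)
            (E := fun x : X ↦ TangentSpace (𝓡 3) x →L[ℝ] TangentSpace (𝓡 3) x →L[ℝ] ℝ) q.2 (secP q))
          {p : ℝ × X | Rstar < p.1} →
        (∀ q : (ℝ × ℝ) × X, Rstar < q.1.1 → q.2 ∈ e.breatheCarrier z₀ r → secS q = secE (q.1.2, q.2)) →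
        (∀ q : (ℝ × ℝ) × X, q.2 ∉ AFEnd.breatheCore e z₀ r → secS q = secP (q.1.1, q.2)) →
        ContMDiffOn ((𝓘(ℝ, ℝ).prod 𝓘(ℝ, ℝ)).prod (𝓡 3)) ((𝓡 3).prod 𝓘(ℝ, E3 →L[ℝ] E3 →L[ℝ] ℝ)) ∞
          (fun q : (ℝ × ℝ) × X ↦ TotalSpace.mk' (E3 →L[ℝ] E3 →L[ℝ] ℝ)
            (E := fun x : X ↦ TangentSpace (𝓡 3) x →L[ℝ] TangentSpace (𝓡 3) x →L[ℝ] ℝ) q.2 (secS q))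
          {p : (ℝ × ℝ) × X | Rstar < p.1.1} := by
      intro secS secE secP hE hP hcar hcore q hq
      have hq' : Rstar < q.1.1 := hq
      apply ContMDiffAt.contMDiffWithinAt
      by_cases hx : q.2 ∈ e.breatheCarrier z₀ r
      · -- on the carrier `S = E`
        have hsm : ContMDiffAt ((𝓘(ℝ, ℝ).prod 𝓘(ℝ, ℝ)).prod (𝓡 3)) ((𝓡 3).prod 𝓘(ℝ, E3 →L[ℝ] E3 →L[ℝ] ℝ)) ∞
            (fun q : (ℝ × ℝ) × X ↦ TotalSpace.mk' (E3 →L[ℝ] E3 →L[ℝ] ℝ)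
              (E := fun x : X ↦ TangentSpace (𝓡 3) x →L[ℝ] TangentSpace (𝓡 3) x →L[ℝ] ℝ) q.2
                (secE (q.1.2, q.2))) q :=
          (hE (q.1.2, q.2)).comp q (hproj₂ q)
        refine hsm.congr_of_eventuallyEq ?_
        have hev₁ : ∀ᶠ p : (ℝ × ℝ) × X in 𝓝 q, Rstar < p.1.1 := hopen.mem_nhds hq'
        have hev₂ : ∀ᶠ p : (ℝ × ℝ) × X in 𝓝 q, p.2 ∈ e.breatheCarrier z₀ r :=
          (continuousAt_snd (p := q)).preimage_mem_nhds ((e.isOpen_breatheCarrier z₀ r).mem_nhds hx)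
        have hev := hev₁.and hev₂
        filter_upwards [hev] with p hp
        rw [hcar p hp.1 hp.2]
      · -- off the carrier, hence off the moved set: `S = P`
        have hK : q.2 ∉ AFEnd.breatheCore e z₀ r := fun h ↦ hx (AFEnd.breatheCore_subset_carrier B h)
        have hmem : (q.1.1, q.2) ∈ {p : ℝ × X | Rstar < p.1} := hq'
        have hPat : ContMDiffAt (𝓘(ℝ, ℝ).prod (𝓡 3)) ((𝓡 3).prod 𝓘(ℝ, E3 →L[ℝ] E3 →L[ℝ] ℝ)) ∞
            (fun q : ℝ × X ↦ TotalSpace.mk' (E3 →L[ℝ] E3 →L[ℝ] ℝ)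
              (E := fun x : X ↦ TangentSpace (𝓡 3) x →L[ℝ] TangentSpace (𝓡 3) x →L[ℝ] ℝ) q.2 (secP q))
            (q.1.1, q.2) :=
          (hP _ hmem).contMDiffAt ((isOpen_lt continuous_const continuous_fst).mem_nhds hmem)
        have hsm : ContMDiffAt ((𝓘(ℝ, ℝ).prod 𝓘(ℝ, ℝ)).prod (𝓡 3)) ((𝓡 3).prod 𝓘(ℝ, E3 →L[ℝ] E3 →L[ℝ] ℝ)) ∞
            (fun q : (ℝ × ℝ) × X ↦ TotalSpace.mk' (E3 →L[ℝ] E3 →L[ℝ] ℝ)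
              (E := fun x : X ↦ TangentSpace (𝓡 3) x →L[ℝ] TangentSpace (𝓡 3) x →L[ℝ] ℝ) q.2
                (secP (q.1.1, q.2))) q :=
          hPat.comp q (hproj₁ q)
        refine hsm.congr_of_eventuallyEq ?_
        have hev : ∀ᶠ p : (ℝ × ℝ) × X in 𝓝 q, p.2 ∉ AFEnd.breatheCore e z₀ r :=
          (continuousAt_snd (p := q)).preimage_mem_nhds
            ((AFEnd.isCompact_breatheCore B).isClosed.isOpen_compl.mem_nhds hK)
        filter_upwards [hev] with p hp
        rw [hcore p hp]
    refine ⟨key (fun q ↦ (S q.1).h.inner q.2) (fun q ↦ (E q.1).h.inner q.2) (fun q ↦ (P q.1).h.inner q.2)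
        hEh hP.1 (fun q hq hx ↦ ?_) (fun q hx ↦ ?_),
      key (fun q ↦ (S q.1).k q.2) (fun q ↦ (E q.1).k q.2) (fun q ↦ (P q.1).k q.2)
        hEk hP.2 (fun q hq hx ↦ ?_) (fun q hx ↦ ?_)⟩
    · exact (hSE q.1.2 (hagree_breathe hq q.1.2 (hcarrier hq hx))).1
    · exact (AFEnd.breatheFamily_eq_of_not_mem_core B (P q.1.1) q.1.2 hx).1
    · exact (hSE q.1.2 (hagree_breathe hq q.1.2 (hcarrier hq hx))).2
    · exact (AFEnd.breatheFamily_eq_of_not_mem_core B (P q.1.1) q.1.2 hx).2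
  · -- the marker point lies below `R⋆`
    exact ParametricKerrBurial.not_mem_far_of_mem_carrier e hzr le_rfl (AFEnd.center_mem B).1
  · -- the marker is injective
    exact (AFEnd.injective_marker B d hv₀).injOn
  · -- admissibility of `S (R, t)`
    obtain ⟨hPadm, -, -⟩ := hPR R hRR
    have hvacP : ∀ [(P R).metric.HasLeviCivita], (P R).IsVacuumConstraintSolution := fun {inst} ↦ (hPadm.1).1
    refine InitialDataSet.mem_admissibleVacuumData_of_agree_off_compact hPadm ?_
      (AFEnd.isCompact_breatheCore B) (fun x hx ↦ AFEnd.breatheFamily_eq_of_not_mem_core B (P R) t hx)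
    intro inst
    haveI : (P R).metric.HasLeviCivita := (P R).metric.hasLeviCivita
    exact AFEnd.isVacuumConstraintSolution_breatheFamily B (P R) hvacP t
  · -- the throat shield of `S (R, t)`
    exact throatBreathing_shield_breatheFamily B (hPR R hRR).2.1 t

end Summit.FinalStateConjecture.FinalStateConjecture.Theorems.SwallowTheDatum.UniversalWitnessFamily

end
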